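import Summits.Parity.GeneralizedHardyLittlewood.Theorems.PrimeLevelFamEdgeMomentsBeyondDiagonalDiagBoxTailFinal
import HarnessLib

/-!
# Route `PrimeLevelFamEdge`, crux K_A `MomentsBeyondDiagonal` (stmt-Parity-20007), line «petersson_layers» v4, stub `stub_diag`:
# **`SubDiag` ⟸ THE ASYMPTOTICS OF THE EXPLICIT LINE SERIES** (census R4, the interface)

After `…DiagBoxTailFinal` (p812287: `diagPart` = explicit order-`(i,j)` line series + `O_{P,Q}(1)` on `0 < Δ' ≤ 3/2`) the registered
stub `stub_diag : SubDiag` FOLLOWS from an asymptotic of the explicit line series alone: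

* `hasShape_diagPart_of_lineSeries` — if for every admissible `P`, even-or-odd `Q` and `Δ' ∈ (1, Δ]` (`Δ ≤ 3/2`) the line series is
  `2ζ(2)² q̂/(Δ'² log² q̂) · t(Δ',P,Q) + O(q̂ log⁻³ q̂)` for a level-free `t`, then `HasShape diagPart Δ t`
  (`‖diagPart − main‖ ≤ ‖diagPart − series‖ + ‖series − main‖ ≤ C₁ + C q̂ℓ⁻³ ≤ (27C₁ + C) q̂ℓ⁻³`, as `ℓ³ ≤ 27 q̂`);
* `subDiag_of_lineSeries` — hence `SubDiag`.

So what remains of `stub_diag` is EXACTLY: the main term of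
`Σ_{i,j} QᵢQⱼℓ^{−(i+j)}(1+(−1)^{i+j}) q̂ Σ_{m₁,m₂≤M} x_{m₁}x_{m₂} Σ_{d₁∣m₁,d₂∣m₂} c (m₁m₂)^{−1/2} 𝔚_{ij}(A₁,A₂;K/q̂²)` with
`𝔚_{ij} = Σ_{a,b} C(i,a)C(j,b)A₁^{i−a}A₂^{j−b} c_{ab}` (`…DiagBoseOuter`), `c_{ab} ≪ e^{−√y}` (`…DiagBoseDecay`), `c₀₀ = 𝒲`
(`…DiagBoseZero`): census R2 (small-`y` expansion of `c_{ab}`) and R3 (the five-variable Möbius sums), conjecturally with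
`t = KMV2000.secondMomentForm` (proved at `(X²,1)`, `…DiagXSqOne`). Helper `--supports stmt-Parity-20007`; closes nothing; K_A, K_B and
the Parity summit are NOT proved; nothing about Landau–Siegel zeros.
-/

noncomputable section

open scoped Real
open Complex MeasureTheory Polynomial
open Literature.NumberTheory.LFunctions

namespace Summit.Parity.GeneralizedHardyLittlewood.Theorems.MomentsBeyondDiagonal.DiagLines

open Summit.Parity.GeneralizedHardyLittlewood.Theorems.PrimeLevelFamEdgeIdeaDeltas.PeterssonLayers
  (diagPart HasShape SubOf SubDiag)

/-- `(log q̂)³ ≤ 27 q̂` for `q̂ ≥ 1` (`log x ≤ 3 x^{1/3}`). [folklore] -/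
theorem log_pow_three_le_mul {Q : ℝ} (hQ : 1 ≤ Q) : Real.log Q ^ 3 ≤ 27 * Q := by
  have h0 : 0 ≤ Real.log Q := Real.log_nonneg hQ
  have h1 : Real.log Q ≤ 3 * Q ^ (1 / 3 : ℝ) := by
    have := Real.log_le_rpow_div (zero_le_one.trans hQ) (by norm_num : (0 : ℝ) < 1 / 3)
    linarith
  calc Real.log Q ^ 3 ≤ (3 * Q ^ (1 / 3 : ℝ)) ^ 3 := pow_le_pow_left₀ h0 h1 3
    _ = 27 * (Q ^ (1 / 3 : ℝ)) ^ (3 : ℕ) := by ring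
    _ = 27 * Q := by
        rw [← Real.rpow_natCast (Q ^ (1 / 3 : ℝ)) 3, ← Real.rpow_mul (zero_le_one.trans hQ)]
        norm_num

/-- **`HasShape diagPart` from the asymptotics of the explicit line series** (census R4 interface): for `1 < Δ ≤ 3/2` and a
level-free functional `t`, if the explicit order-`(i,j)` line series of `…DiagLineSeries` is
`2ζ(2)² q̂/(Δ'² log² q̂)·t(Δ',P,Q) + O(q̂ log⁻³ q̂)` for every admissible `P`, even-or-odd `Q`, `Δ' ∈ (1, Δ]`, then so is `diagPart`.
[cite: KowalskiMichelVanderKam2000, (23)–(28) pp. 13–15 — derivation] -/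
theorem hasShape_diagPart_of_lineSeries {Δ : ℝ} (hΔ : Δ ≤ 3 / 2) (t : ℝ → ℝ[X] → ℝ[X] → ℝ)
    (h : ∀ P Q : ℝ[X], KMV2000.Admissible P → KMV2000.IsEvenOrOdd Q → ∀ Δ' : ℝ, 1 < Δ' → Δ' ≤ Δ →
      ∃ C : ℝ, ∃ q₀ : ℕ, ∀ (q : ℕ) [NeZero q], q₀ ≤ q →
        ‖∑ i ∈ Finset.range (Q.natDegree + 1), ∑ j ∈ Finset.range (Q.natDegree + 1),
          (Q.coeff i : ℂ) * (Q.coeff j : ℂ) * (((Real.log (KMV2000.qhat q))⁻¹ : ℝ) : ℂ) ^ (i + j) *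
            (1 + (-1 : ℂ) ^ (i + j)) * (KMV2000.qhat q : ℂ) *
          ∑ m₁ ∈ Finset.Icc 1 ⌊KMV2000.qhat q ^ Δ'⌋₊, ∑ m₂ ∈ Finset.Icc 1 ⌊KMV2000.qhat q ^ Δ'⌋₊,
            (KMV2000.mollifierCoeff P (KMV2000.qhat q ^ Δ') m₁ : ℂ) *
              (KMV2000.mollifierCoeff P (KMV2000.qhat q ^ Δ') m₂ : ℂ) *
            ∑ d₁ ∈ m₁.divisors, ∑ d₂ ∈ m₂.divisors,
              (((((m₁ / d₁).gcd (m₂ / d₂) : ℝ) * ((m₁ : ℝ) * m₂) ^ (-(1 / 2 : ℝ)) *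
                (∫ u₁ in Set.Ioi (0 : ℝ),
                  (Real.log (KMV2000.qhat q / ((d₁ * (m₂ / d₂ / (m₁ / d₁).gcd (m₂ / d₂)) : ℕ) : ℝ)) + Real.log u₁) ^ i *
                  ∫ u₂ in Set.Ioi (((((m₁ / (m₁ / d₁).gcd (m₂ / d₂)) * (m₂ / (m₁ / d₁).gcd (m₂ / d₂)) : ℕ) : ℝ) /
                      KMV2000.qhat q ^ 2) / u₁),
                    Real.exp (-(u₁ + u₂)) / (1 - Real.exp (-(u₁ + u₂))) ^ 2 *
                    (Real.log (KMV2000.qhat q / ((d₂ * (m₁ / d₁ / (m₁ / d₁).gcd (m₂ / d₂)) : ℕ) : ℝ)) + Real.log u₂) ^ j)) : ℝ) : ℂ) -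
          ((2 * riemannZeta 2 ^ 2 *
              ((KMV2000.qhat q / (Δ' ^ 2 * Real.log (KMV2000.qhat q) ^ 2) : ℝ) : ℂ)) * ((t Δ' P Q : ℝ) : ℂ))‖ ≤
          C * KMV2000.qhat q * (Real.log (KMV2000.qhat q))⁻¹ ^ 3) :
    HasShape (fun q _ P Q Δ' ↦ diagPart q P Q Δ') Δ t := by
  intro P Q hP hQ Δ' h1 h2
  obtain ⟨C, q₀, hC⟩ := h P Q hP hQ Δ' h1 h2
  obtain ⟨C₁, hC₁⟩ := norm_diagPart_sub_lineSeries_le_const P Q (by linarith) (h2.trans hΔ)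
  refine ⟨27 * max C₁ 0 + C, max q₀ 400, fun q _ _ hq _ ↦ ?_⟩
  have hq₀ : q₀ ≤ q := (le_max_left _ _).trans hq
  have hq400 : 400 ≤ q := (le_max_right _ _).trans hq
  have hQ3 : 3 ≤ KMV2000.qhat q := FirstOrderAFE.three_le_qhat hq400
  have hQ1 : 1 ≤ KMV2000.qhat q := by linarith
  have hQ0 : 0 < KMV2000.qhat q := by linarith
  have hℓ0 : 0 < Real.log (KMV2000.qhat q) := Real.log_pos (by linarith)
  have htail := hC₁ q hq400
  have hmain := hC q hq₀
  -- `C₁ ≤ 27 max(C₁,0) q̂ ℓ⁻³`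
  have hunit : (1 : ℝ) ≤ 27 * KMV2000.qhat q * (Real.log (KMV2000.qhat q))⁻¹ ^ 3 := by
    have hl := log_pow_three_le_mul hQ1
    rw [inv_pow, ← div_eq_mul_inv, le_div_iff₀ (pow_pos hℓ0 3)]
    linarith
  have hC₁' : C₁ ≤ 27 * max C₁ 0 * (KMV2000.qhat q * (Real.log (KMV2000.qhat q))⁻¹ ^ 3) := by
    calc C₁ ≤ max C₁ 0 := le_max_left _ _
      _ = max C₁ 0 * 1 := (mul_one _).symm
      _ ≤ max C₁ 0 * (27 * KMV2000.qhat q * (Real.log (KMV2000.qhat q))⁻¹ ^ 3) :=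
          mul_le_mul_of_nonneg_left hunit (le_max_right _ _)
      _ = _ := by ring
  calc ‖diagPart q P Q Δ' - ((2 * riemannZeta 2 ^ 2 *
          ((KMV2000.qhat q / (Δ' ^ 2 * Real.log (KMV2000.qhat q) ^ 2) : ℝ) : ℂ)) * ((t Δ' P Q : ℝ) : ℂ))‖
      ≤ ‖diagPart q P Q Δ' - ∑ i ∈ Finset.range (Q.natDegree + 1), ∑ j ∈ Finset.range (Q.natDegree + 1),
          (Q.coeff i : ℂ) * (Q.coeff j : ℂ) * (((Real.log (KMV2000.qhat q))⁻¹ : ℝ) : ℂ) ^ (i + j) *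
            (1 + (-1 : ℂ) ^ (i + j)) * (KMV2000.qhat q : ℂ) *
          ∑ m₁ ∈ Finset.Icc 1 ⌊KMV2000.qhat q ^ Δ'⌋₊, ∑ m₂ ∈ Finset.Icc 1 ⌊KMV2000.qhat q ^ Δ'⌋₊,
            (KMV2000.mollifierCoeff P (KMV2000.qhat q ^ Δ') m₁ : ℂ) *
              (KMV2000.mollifierCoeff P (KMV2000.qhat q ^ Δ') m₂ : ℂ) *
            ∑ d₁ ∈ m₁.divisors, ∑ d₂ ∈ m₂.divisors,
              (((((m₁ / d₁).gcd (m₂ / d₂) : ℝ) * ((m₁ : ℝ) * m₂) ^ (-(1 / 2 : ℝ)) *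
                (∫ u₁ in Set.Ioi (0 : ℝ),
                  (Real.log (KMV2000.qhat q / ((d₁ * (m₂ / d₂ / (m₁ / d₁).gcd (m₂ / d₂)) : ℕ) : ℝ)) + Real.log u₁) ^ i *
                  ∫ u₂ in Set.Ioi (((((m₁ / (m₁ / d₁).gcd (m₂ / d₂)) * (m₂ / (m₁ / d₁).gcd (m₂ / d₂)) : ℕ) : ℝ) /
                      KMV2000.qhat q ^ 2) / u₁),
                    Real.exp (-(u₁ + u₂)) / (1 - Real.exp (-(u₁ + u₂))) ^ 2 *
                    (Real.log (KMV2000.qhat q / ((d₂ * (m₁ / d₁ / (m₁ / d₁).gcd (m₂ / d₂)) : ℕ) : ℝ)) + Real.log u₂) ^ j)) : ℝ) : ℂ)‖ +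
        ‖∑ i ∈ Finset.range (Q.natDegree + 1), ∑ j ∈ Finset.range (Q.natDegree + 1),
          (Q.coeff i : ℂ) * (Q.coeff j : ℂ) * (((Real.log (KMV2000.qhat q))⁻¹ : ℝ) : ℂ) ^ (i + j) *
            (1 + (-1 : ℂ) ^ (i + j)) * (KMV2000.qhat q : ℂ) *
          ∑ m₁ ∈ Finset.Icc 1 ⌊KMV2000.qhat q ^ Δ'⌋₊, ∑ m₂ ∈ Finset.Icc 1 ⌊KMV2000.qhat q ^ Δ'⌋₊,
            (KMV2000.mollifierCoeff P (KMV2000.qhat q ^ Δ') m₁ : ℂ) *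
              (KMV2000.mollifierCoeff P (KMV2000.qhat q ^ Δ') m₂ : ℂ) *
            ∑ d₁ ∈ m₁.divisors, ∑ d₂ ∈ m₂.divisors,
              (((((m₁ / d₁).gcd (m₂ / d₂) : ℝ) * ((m₁ : ℝ) * m₂) ^ (-(1 / 2 : ℝ)) *
                (∫ u₁ in Set.Ioi (0 : ℝ),
                  (Real.log (KMV2000.qhat q / ((d₁ * (m₂ / d₂ / (m₁ / d₁).gcd (m₂ / d₂)) : ℕ) : ℝ)) + Real.log u₁) ^ i *
                  ∫ u₂ in Set.Ioi (((((m₁ / (m₁ / d₁).gcd (m₂ / d₂)) * (m₂ / (m₁ / d₁).gcd (m₂ / d₂)) : ℕ) : ℝ) /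
                      KMV2000.qhat q ^ 2) / u₁),
                    Real.exp (-(u₁ + u₂)) / (1 - Real.exp (-(u₁ + u₂))) ^ 2 *
                    (Real.log (KMV2000.qhat q / ((d₂ * (m₁ / d₁ / (m₁ / d₁).gcd (m₂ / d₂)) : ℕ) : ℝ)) + Real.log u₂) ^ j)) : ℝ) : ℂ) -
          ((2 * riemannZeta 2 ^ 2 *
              ((KMV2000.qhat q / (Δ' ^ 2 * Real.log (KMV2000.qhat q) ^ 2) : ℝ) : ℂ)) * ((t Δ' P Q : ℝ) : ℂ))‖ :=
        norm_sub_le_norm_sub_add_norm_sub _ _ _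
    _ ≤ C₁ + C * KMV2000.qhat q * (Real.log (KMV2000.qhat q))⁻¹ ^ 3 := add_le_add htail hmain
    _ ≤ 27 * max C₁ 0 * (KMV2000.qhat q * (Real.log (KMV2000.qhat q))⁻¹ ^ 3) +
        C * KMV2000.qhat q * (Real.log (KMV2000.qhat q))⁻¹ ^ 3 := by linarith
    _ = (27 * max C₁ 0 + C) * KMV2000.qhat q * (Real.log (KMV2000.qhat q))⁻¹ ^ 3 := by ring

/-- **`SubDiag` from the asymptotics of the explicit line series** on some window `(1, Δ]`, `Δ ≤ 3/2` (census R4 interface).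
[cite: KowalskiMichelVanderKam2000, (23)–(28) pp. 13–15 — derivation] -/
theorem subDiag_of_lineSeries {Δ : ℝ} (hΔ1 : 1 < Δ) (hΔ : Δ ≤ 3 / 2) (t : ℝ → ℝ[X] → ℝ[X] → ℝ)
    (h : ∀ P Q : ℝ[X], KMV2000.Admissible P → KMV2000.IsEvenOrOdd Q → ∀ Δ' : ℝ, 1 < Δ' → Δ' ≤ Δ →
      ∃ C : ℝ, ∃ q₀ : ℕ, ∀ (q : ℕ) [NeZero q], q₀ ≤ q →
        ‖∑ i ∈ Finset.range (Q.natDegree + 1), ∑ j ∈ Finset.range (Q.natDegree + 1),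
          (Q.coeff i : ℂ) * (Q.coeff j : ℂ) * (((Real.log (KMV2000.qhat q))⁻¹ : ℝ) : ℂ) ^ (i + j) *
            (1 + (-1 : ℂ) ^ (i + j)) * (KMV2000.qhat q : ℂ) *
          ∑ m₁ ∈ Finset.Icc 1 ⌊KMV2000.qhat q ^ Δ'⌋₊, ∑ m₂ ∈ Finset.Icc 1 ⌊KMV2000.qhat q ^ Δ'⌋₊,
            (KMV2000.mollifierCoeff P (KMV2000.qhat q ^ Δ') m₁ : ℂ) *
              (KMV2000.mollifierCoeff P (KMV2000.qhat q ^ Δ') m₂ : ℂ) *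
            ∑ d₁ ∈ m₁.divisors, ∑ d₂ ∈ m₂.divisors,
              (((((m₁ / d₁).gcd (m₂ / d₂) : ℝ) * ((m₁ : ℝ) * m₂) ^ (-(1 / 2 : ℝ)) *
                (∫ u₁ in Set.Ioi (0 : ℝ),
                  (Real.log (KMV2000.qhat q / ((d₁ * (m₂ / d₂ / (m₁ / d₁).gcd (m₂ / d₂)) : ℕ) : ℝ)) + Real.log u₁) ^ i *
                  ∫ u₂ in Set.Ioi (((((m₁ / (m₁ / d₁).gcd (m₂ / d₂)) * (m₂ / (m₁ / d₁).gcd (m₂ / d₂)) : ℕ) : ℝ) /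
                      KMV2000.qhat q ^ 2) / u₁),
                    Real.exp (-(u₁ + u₂)) / (1 - Real.exp (-(u₁ + u₂))) ^ 2 *
                    (Real.log (KMV2000.qhat q / ((d₂ * (m₁ / d₁ / (m₁ / d₁).gcd (m₂ / d₂)) : ℕ) : ℝ)) + Real.log u₂) ^ j)) : ℝ) : ℂ) -
          ((2 * riemannZeta 2 ^ 2 *
              ((KMV2000.qhat q / (Δ' ^ 2 * Real.log (KMV2000.qhat q) ^ 2) : ℝ) : ℂ)) * ((t Δ' P Q : ℝ) : ℂ))‖ ≤
          C * KMV2000.qhat q * (Real.log (KMV2000.qhat q))⁻¹ ^ 3) :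
    SubDiag :=
  ⟨Δ, hΔ1, t, hasShape_diagPart_of_lineSeries hΔ t h⟩

end Summit.Parity.GeneralizedHardyLittlewood.Theorems.MomentsBeyondDiagonal.DiagLines

end
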